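import Literature.MathematicalPhysics.QuantumFieldTheory.Balaban1983to89.B9Thm37CommutatorBound389
import Literature.MathematicalPhysics.QuantumFieldTheory.Balaban1983to89.B6Cover236MultiLevelTorusReach

/-!
# `Balaban1983to89.B9Thm37CommutatorBound389Majorant` — T. Bałaban, *Propagators for lattice gauge theories in a background field*,
# Commun. Math. Phys. **99** (1985) 389–434 [Balaban1985BackgroundPropagators], Sect. C pp. 409–410, (3.89) ⇒ Thm 3.7: THE `h389` SLOT OF THE
# SUMMATION `B9Thm37Sum.thm37_entry1` — the block majorant `1[y ∈ S′_□]·θ·e^{−δ d(y,y′)}` of the conjugated remainder letter `R′_□ = K(h_□)G′_□h_□`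
# on real coordinates, `θ = M₂(Σ_j‖b_j‖)·θ₃₈₉∕(L·M_h)`, for ANY cube letter obeying (3.42)₀,₁ (sub-row G-B9-LETTERS, module M5.4-est, file 2)

statement-level skeleton of published theorems with citation tags; proofs where landed; nothing here is a claim about the Yang–Mills mass gap

p. 409: «Δ′_a G′₀ = I − Σ_□ K(h_□)G′_□h_□ = I − R′. Using the inequalities (3.42) for G′_□, we get the bound |(K(h_□)G′_□h_□λ)(x)| ≤ O(M⁻¹)
e^{−δ₀(Lʲη)⁻¹|y−y′|}|λ| (3.89) for x ∈ Δ(y), supp λ ⊂ Δ(y′), y, y′ ∈ □ ∈ 𝒟_j»; p. 410: «These properties of R′ imply that for M sufficiently large the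
inverse (I − R′)⁻¹ exists … we can apply Lemma 2.1 of [4] in order to prove that [G′₀(I − R′)⁻¹] satisfies the required bounds» — the summation is
dag-w3's `B9Thm37Sum.thm37_entry1`, whose hypothesis `h389 : ∀ □, HasMajorant blk (Rl □) (fun a b ↦ if a ∈ S′ □ then θ·e^{−δ₀ d(a,b)} else 0)` THIS
FILE SERVES, in the frame of def-Y's reading dictionary `Node00.OpsYRead342` (block map `(z, j) ↦ ιB(Δ(z))`, geometry `toB6 (geo9K i) Rr Hp`, real
coordinates `conj b`), as agreed with the M5.5 consumer (lit-balaban-p21 g30, cell bus 2026-08-28T01:53Z: «Rl □ := conj b (K(h_□)G′_□h_□)», S′ at index bonds).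

## WHAT THIS FILE PROVES (THEOREMS only; 0 `def … : Prop`, 0 sorry, standard axioms)
* `norm_liftY_le` (`‖(f ⊗ E)(w)‖ ≤ |f(w)|` for `‖E‖ ≤ 1`), `smul_comm_of_eq_KhY` (an ℝ-linear `Rl` agreeing with `Λ ↦ K(h_□)(V)(O(h_□Λ))` is ℂ-homogeneous);
* ★★ `hasMajorant_conj_of_bound389` — **THE `h389` SLOT**: under the hypotheses of file 1's `norm_KhY_O_hTY_apply_le` (member with `η = |c_f|⁻¹`, corner-free
  section `ιB` of `β`, bi-contraction bond variables and averaging transporters, the cube letter's (3.42)₀,₁ at rate `δ ≥ 0` DISPLAYED as hypotheses), a real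
  basis `b` of `𝔸` with coordinate bound `M₂`, an ℝ-linear `Rl` with `Rl Λ = K(h_□)(V)(O(h_□Λ))`, and ANY finset `S′ ⊇ {a : βa ∈ QT □}` of index bonds:
  `HasMajorant (g := toB6 (geo9K i) Rr Hp) (fun p ↦ ιB (Δ(p.1))) (conj b Rl) (fun a a′ ↦ if a ∈ S′ then M₂(Σ_j‖b_j‖)·θ₃₈₉∕(L·M_h)·e^{−δ d(a,a′)} else 0)`
  — print's «majorant O(M⁻¹)e^{−δ₀d} localised to the cube» (off `S′` the letter VANISHES on the block: file 1's `blkOf_mem_QT_of_KhY_hTY_ne_zero`);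
* `sum_indicator_QT_le` — the overlap count feeding `hcnt′`: `Σ_□ 1[βa ∈ QT □] ≤ 3·5^{d+1}` (p21 gen-5's `B6Cover236MultiLevelTorusReach.card_filter_mem_QT_le`).
HONEST SCOPE.  As file 1: (3.42)₀,₁ of the cube letter are HYPOTHESES (modules M5.1∕M5.2 supply them); same rate `δ` as the input; corner-free members;
`η = |c_f|⁻¹` a hypothesis; the choice «M sufficiently large» and the Neumann series are NOT here (they are `thm37_entry1`'s `hsmall`); nothing of Thm 3.7 ∕
Lemma 2.1 ∕ (3.42) asserted; nothing continuum ∕ OS ∕ mass gap ∕ Clay; YM mass gap NOT proved by any of this (Track A conditional rung).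
`--supports stmt-QuantumFields-19200`.  Net new unproved facts: 0.
-/

noncomputable section

namespace Literature.MathematicalPhysics.QuantumFieldTheory.Balaban1983to89.B9Thm37CommutatorBound389Majorant

open Node00
open B9Thm37CubeCoverCommutators
open B9Thm37CubeCoverCommutatorSizes
open B9Thm37CommutatorBound389
open B6KLevelCensusIndexV1 (KIdx)
open B6Ineq2142KLevelV1 (β)
open B6Geom246MultiLevelBox (bset blkOf)
open B6Cover236MultiLevelBlocks (cubes)
open B6Partition118KLevelTorusCentral (QT)
open B6RandomWalk (HasMajorant hasMajorant_mono)
open B9Thm34Ext (toB6)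
open B9GeoNormsKLevelV1 (geo9K)
open B9Eq352DivFormLetters (conj)
open scoped Matrix

variable {𝔸 : Type} [NormedRing 𝔸] [NormedAlgebra ℂ 𝔸] [CompleteSpace 𝔸]
variable {d ℓ : ℕ} {hd : 1 ≤ d + 1} {hL : Odd (ℓ + 1) ∧ 1 < ℓ + 1} {b₀ b₁ : ℝ}
variable {ι : Type} [Fintype ι]
variable (i : KIdx d ℓ hd hL b₀ b₁) (b : Module.Basis ι ℝ 𝔸)

omit [CompleteSpace 𝔸] in
/-- the product-form test function `f ⊗ E` with `‖E‖ ≤ 1` has the profile of `f`: `‖(f ⊗ E)(w)‖ ≤ |f(w)|`.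
[cite: Balaban1985BackgroundPropagators, (3.39) p.397, bookkeeping] -/
theorem norm_liftY_le {X : Type} (f : X → ℝ) {E : 𝔸} (hE : ‖E‖ ≤ 1) (w : X) : ‖liftY f E w‖ ≤ |f w| := by
  rw [liftY_apply, norm_ofReal_smul]
  calc |f w| * ‖E‖ ≤ |f w| * 1 := mul_le_mul_of_nonneg_left hE (abs_nonneg _)
    _ = |f w| := mul_one _

/-- an ℝ-linear `Rl` agreeing with `Λ ↦ K(h_□)(V)(O(h_□Λ))` (three ℂ-linear maps) is ℂ-homogeneous. [cite: Balaban1985BackgroundPropagators, (3.88) p.409, bookkeeping] -/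
theorem smul_comm_of_eq_KhY (par : SiteParY 𝔸 i) (c : ↥(cubes i.D.toDomains)) (V : CfgY 𝔸 i) (O : (SiteY i → 𝔸) →ₗ[ℂ] (SiteY i → 𝔸))
    (Rl : Module.End ℝ (SiteY i → 𝔸)) (hRl : ∀ Λ, Rl Λ = KhY i par (hTY i c) V (O (cutMulY (hTY i c) Λ))) (a : ℂ) (Λ : SiteY i → 𝔸) :
    Rl (a • Λ) = a • Rl Λ := by
  rw [hRl, hRl, map_smul, map_smul, map_smul]

section Majorant

variable [Fintype (geo9K i).Site] {Rr : ℝ} {Hp : Prop}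

/-- ★★ **THE `h389` SLOT OF THM 3.7's SUMMATION** — for ANY cube letter `O` at `V` with (3.42)₀,₁ displayed (`h342₀`, `h342₁`, constants `B₀, δ`), an
ℝ-linear `Rl` with `Rl Λ = K(h_□)(V)(O(h_□Λ))`, a real basis `b` (coordinate bound `M₂`) and any `S′ ⊇ {a : βa ∈ QT □}`: the conjugated remainder letter
`conj b Rl` has the block majorant `1[a ∈ S′]·M₂(Σ_j‖b_j‖)·θ₃₈₉∕(L·M_h)·e^{−δ d(a,a′)}` w.r.t. `(z, j) ↦ ιB(Δ(z))` — print's «|(K(h_□)G′_□h_□λ)(x)| ≤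
O(M⁻¹)e^{−δ₀(Lʲη)⁻¹|y−y′|}|λ| … y, y′ ∈ □», in the shape of `B9Thm37Sum.thm37_entry1`'s hypothesis `h389`.
[cite: Balaban1985BackgroundPropagators, (3.89) p.409, Thm 3.7 proof p.410; Balaban1984PropagatorsII, (2.44) p.230, (2.51) p.232] -/
theorem hasMajorant_conj_of_bound389 (par : SiteParY 𝔸 i) (c : ↥(cubes i.D.toDomains)) (V : CfgY 𝔸 i)
    (O : (SiteY i → 𝔸) →ₗ[ℂ] (SiteY i → 𝔸)) {B₀ δ : ℝ} (hB₀ : 0 ≤ B₀) (hδ : 0 ≤ δ)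
    (hη : etaS i = |i.cf|⁻¹) (ιB : BlkY i → IBondY i) (hι : ∀ s, β i.hN i.D i.hk (ιB s) = s)
    (hV : ∀ (μ : Fin (d + 1)) (x : SiteY i), ‖(UboxY i V μ x : 𝔸)‖ ≤ 1 ∧ ‖(((UboxY i V μ x)⁻¹ : 𝔸ˣ) : 𝔸)‖ ≤ 1)
    (hT : ∀ z w : SiteY i, ‖(avgTrY i par V z w : 𝔸)‖ ≤ 1 ∧ ‖(((avgTrY i par V z w)⁻¹ : 𝔸ˣ) : 𝔸)‖ ≤ 1)
    (h342₀ : ∀ (f : SiteY i → ℝ) (y y' : IBondY i), (geo9K i).suppIn (Sum.inl f) y' →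
      ∀ Λ : SiteY i → 𝔸, (∀ z, ‖Λ z‖ ≤ |f z|) → ∀ z : SiteY i, blkOf i.D.toDomains z = β i.hN i.D i.hk y →
        etaS i ^ 2 * ‖O Λ z‖ ≤ B₀ * (geo9K i).len y ^ 2 * Real.exp (-(δ * (geo9K i).dist y y')) * (geo9K i).supNorm (Sum.inl f))
    (h342₁ : ∀ (f : SiteY i → ℝ) (y y' : IBondY i), (geo9K i).suppIn (Sum.inl f) y' →
      ∀ Λ : SiteY i → 𝔸, (∀ z, ‖Λ z‖ ≤ |f z|) → ∀ (z : SiteY i) (μ : Fin (d + 1)), blkOf i.D.toDomains z = β i.hN i.D i.hk y →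
        etaS i * ‖cdS i V μ (O Λ) z‖ ≤ B₀ * (geo9K i).len y * Real.exp (-(δ * (geo9K i).dist y y')) * (geo9K i).supNorm (Sum.inl f))
    {M₂ : ℝ} (hM₂ : 0 ≤ M₂) (hrepr : ∀ (v : 𝔸) (j : ι), |b.repr v j| ≤ M₂ * ‖v‖)
    (Rl : Module.End ℝ (SiteY i → 𝔸)) (hRl : ∀ Λ, Rl Λ = KhY i par (hTY i c) V (O (cutMulY (hTY i c) Λ)))
    (S' : Finset (IBondY i)) (hS' : ∀ a : IBondY i, β i.hN i.D i.hk a ∈ QT i.D (B9GeoLemma21KLevelV1.one_le_Mh i) (four_le_P' i) c → a ∈ S') :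
    HasMajorant (g := toB6 (geo9K i) Rr Hp) (fun p : SiteY i × ι => ιB (blkOf i.D.toDomains p.1)) (conj b Rl)
      (fun a a' => if a ∈ S' then M₂ * (∑ j, ‖b j‖) * (theta389 d ℓ B₀ δ / (((ℓ : ℝ) + 1) * i.Mh)) * Real.exp (-(δ * (geo9K i).dist a a'))
        else 0) := by
  classical
  obtain ⟨_, hMh2, _, _⟩ := side_conditions i
  have hθ : 0 ≤ theta389 d ℓ B₀ δ / (((ℓ : ℝ) + 1) * i.Mh) := div_nonneg (theta389_nonneg d ℓ hB₀ δ) (by positivity)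
  -- the localised block bound `W`
  have hW : ∀ a a' : IBondY i, 0 ≤ (if a ∈ S' then theta389 d ℓ B₀ δ / (((ℓ : ℝ) + 1) * i.Mh) * Real.exp (-(δ * (geo9K i).dist a a')) else 0) :=
    fun a a' => by
      split_ifs
      · exact mul_nonneg hθ (Real.exp_pos _).le
      · exact le_rfl
  have hTW : ∀ (f : SiteY i → ℝ) (y y' : IBondY i), (geo9K i).suppIn (Sum.inl f) y' → ∀ E : 𝔸, ‖E‖ ≤ 1 →
      ∀ z : SiteY i, blkOf i.D.toDomains z = β i.hN i.D i.hk y → ‖Rl (liftY f E) z‖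
        ≤ (if y ∈ S' then theta389 d ℓ B₀ δ / (((ℓ : ℝ) + 1) * i.Mh) * Real.exp (-(δ * (geo9K i).dist y y')) else 0)
          * (geo9K i).supNorm (Sum.inl f) := by
    intro f y y' hs E hE z hz
    rw [hRl]
    by_cases hy : y ∈ S'
    · rw [if_pos hy]
      exact norm_KhY_O_hTY_apply_le i par c V O hB₀ hδ hη ιB hι hV hT h342₀ h342₁ f y y' hs (liftY f E) (norm_liftY_le f hE) z hz
    · -- off `S′` the letter vanishes on the block `Δ(βy)` (output localisation)
      have h0 : KhY i par (hTY i c) V (O (cutMulY (hTY i c) (liftY f E))) z = 0 := by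
        by_contra hne
        have hmem := blkOf_mem_QT_of_KhY_hTY_ne_zero i par c V _ z hne
        rw [hz] at hmem
        exact hy (hS' y hmem)
      rw [h0, norm_zero, if_neg hy, zero_mul]
  have h := OpsYRead342.hasMajorant_conj_of_ball_bound (Rr := Rr) (Hp := Hp) i b Rl (smul_comm_of_eq_KhY i par c V O Rl hRl) ιB hι hM₂ hrepr
    (fun a a' => if a ∈ S' then theta389 d ℓ B₀ δ / (((ℓ : ℝ) + 1) * i.Mh) * Real.exp (-(δ * (geo9K i).dist a a')) else 0) hW hTW
  refine hasMajorant_mono (g := toB6 (geo9K i) Rr Hp) _ h fun a a' => le_of_eq ?_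
  show M₂ * (∑ j, ‖b j‖) * (if a ∈ S' then theta389 d ℓ B₀ δ / (((ℓ : ℝ) + 1) * i.Mh) * Real.exp (-(δ * (geo9K i).dist a a')) else 0) = _
  split_ifs
  · ring
  · rw [mul_zero]

end Majorant

/-- **THE OVERLAP COUNT OF THE LOCALISATION SETS** (feeds `hcnt′` of `B9Thm37Sum.thm37_entry1` with `S′_□ = {a : βa ∈ QT □}`): every index bond's block
lies in at most `3·5^{d+1}` of the sets `QT □` (p21 gen-5's `card_filter_mem_QT_le`). [cite: Balaban1985BackgroundPropagators, (3.91) p.410 («□′ ∩ □ ≠ ∅»); Balaban1984PropagatorsII, p.235] -/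
theorem sum_indicator_QT_le (a : IBondY i) :
    (∑ c : ↥(cubes i.D.toDomains),
        if β i.hN i.D i.hk a ∈ QT i.D (B9GeoLemma21KLevelV1.one_le_Mh i) (four_le_P' i) c then (1 : ℝ) else 0) ≤ 3 * 5 ^ (d + 1) := by
  classical
  obtain ⟨_, hMh2, hR, _⟩ := side_conditions i
  rw [Finset.sum_boole]
  exact_mod_cast B6Cover236MultiLevelTorusReach.card_filter_mem_QT_le i.D hMh2 hR (B9GeoLemma21KLevelV1.one_le_Mh i) (four_le_P' i)
    (β i.hN i.D i.hk a)

end Literature.MathematicalPhysics.QuantumFieldTheory.Balaban1983to89.B9Thm37CommutatorBound389Majorant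

end
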